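import Mathlib
import Summits.Ventures.FusionMHD.Models.CerfonFreidbergIterLikeQHalfShearDefs
import HarnessLib

/-!
# Ventures/FusionMHD — Models/CerfonFreidbergIterLikeQHalfShearPanels4.lean: KERNEL CHECK of the shear-register certificates of panels 6, 7 (of 32)
# at `ψ_N = 1/2` of THE Cerfon–Freidberg ITER-like instance

HONEST FRAMING (LADDER-GRIDFUSION three columns; CF rung; successor step of «q′(ψ_N = 1/2) on the CF rung», F2-SCOPING v1.6 §10(c)).  One `decide +kernel`
(≈ 80 s): for each listed panel the obligation `CFIterLike.QHalfShear.ShearCert.ok` (`Models/CerfonFreidbergIterLikeQHalfShearDefs.lean`) — the Taylor-model run of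
`progQ = CFIterLike.QHalf.progA ++ blockQ` over ★ #117's parameter box is ACCEPTED and the kernel's panel-integral enclosure of the shear kernel `K·p` along the
approximant lies inside the claimed integers (read off a compiled `#eval` of the same functions, slack one unit of `2⁻⁶⁰`; float truth inside every panel).
MODELLED: analytic Cerfon–Freidberg family; nothing about a device or stability.  No `native_decide`.  Typer/prover: gridfusion-model-5 (g8), 2026-08-27.
Citations: Freidberg 2014 §6.3.5 (6.35) [Freidberg2014]; Mahboubi–Melquiond–Sibut-Pinote 2016 §3.2 Lemma 3 [MahboubiMelquiondSibutpinote2016].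
-/

namespace Summit.Ventures.FusionMHD.Models.CFIterLike.QHalfShear

/-- Shear-register certificate data of panels 6, 7. [instance data] -/
def shearCert4 : List ShearCert := [
  { j := 6, cand := [126743900120210931712, 380833473018928562176, 1666882981515048255488, 4779887472754209849344, 14876079706830249394176, 40114630039015809613824, 105123249502923612225536, 250235918450350190755840, 232830255899480422350848, -1885310705121875168591872, 1046956547654696253637263360, 5454542091213651164312633344, -1262110342642620776310485549056],
    deg := 10, elog2 := 42, plo := -1167562714509878423, phi := -1167562592621012886 },
  { j := 7, cand := [140434120266580410368, 501045001336953044992, 2216079086867641794560, 7104626892502204416000, 22991297996876188483584, 66026426889737410183168, 177975872168225973207040, 435062914464377487753216, 844036306372175310356480, -8818286479686622657904640, 303221231164222683962408960, 16731373321909618361149423616, -332415501646916375004152070144],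
    deg := 10, elog2 := 42, plo := -1265085993130106877, phi := -1265085869125276978 }]

/-- **KERNEL CHECK** of the shear register on panels 6, 7. -/
theorem shearCert4_ok : CFIterLike.QHalfShear.shearCert4.all ShearCert.ok = true := by
  decide +kernel

end Summit.Ventures.FusionMHD.Models.CFIterLike.QHalfShear
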